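import Literature.AlgebraicGeometry.Motives.HodgeStructureDivisorClassesMixedHom
import HarnessLib

/-!
# Milne 1999, Prop. 4.1 on the abstract carrier: if the divisorial correspondences vanish, the divisor classes of
# `H₁ ⊕ H₂` are the products of those of the factors — `D•(H₁ ⊕ H₂) = D•(H₁) ⊗ D•(H₂)` inside `⋀(V ⊕ W)`

[topic AlgebraicGeometry/Motives]

Layer `Literature/AlgebraicGeometry/Motives`, lane `lit-hodgefound` (Track 2 foundations library; prover seat `lit-hodgefound-p34`,
generation 27, row g27-#2). THEOREMS ONLY (no `def`, no named fact, no instance, no notation; net debt `0`). Sequel of the seat's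
g27-#1 `Motives/HodgeStructureDivisorClassesMixedHom` (`B¹(H₁ ⊕ H₂)_{mixed} ≃ Hom_HS(H₁, H₂)`; the pull-back `⋀²in₁ B¹(H₁) ⊕ ⋀²in₂ B¹(H₂)`
is all of `B¹(H₁ ⊕ H₂)` iff `Hom_HS(H₁, H₂) = 0`), of g26-#7 `Motives/HodgeStructureDivisorClassesDirectSum`, of g26-#6
`Motives/HodgeStructureDivisorClassesFunctoriality` (`⋀ f` maps `Dᵖ` into `Dᵖ`; `map_subtype_map_exteriorPower_map`) and of p02/p29's
`Motives/HodgeStructureExteriorPowerDivisorClasses` (`Dᵖ(H) ⊆ ⋀^{2p} V`, `D⁰ = ℚ`, `D^{p+1} = Dᵖ ∧ B¹`; in the exterior algebra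
`Dᵖ = (B¹)ᵖ`, `map_subtype_divisorClasses`; `Dᵃ ∧ Dᵇ ⊆ D^{a+b}`, `mul_mem_divisorClasses`). The torus-level twin (real `2`-forms on
`E₁ × E₂`, `NS` as hermitian forms) is p08's `Geometry/Kaehler/ComplexTorusDivisorClassesKunneth` — BY NAME only, nothing restated: here the
carrier is the abstract `ℚ`-Hodge structure `H₁ ⊕ H₂` and its exterior algebra `⋀(V ⊕ W)`.

## The source, verbatim

J. S. Milne, *Lefschetz classes on abelian varieties*, Duke Math. J. 96 (1999) [Milne1999LefschetzClasses] (held text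
`paper:doi-10-1215-s0012-7094-99-09620-5`, p0020 L9–L41): "**Proposition 4.1.** Let `X` and `Y` be smooth complete varieties over
`Ω`. If the `ℚ`-space `DC(X, Y)` of divisorial correspondences between `X` and `Y` is zero, then the map
`x ⊗ y ↦ p^*x · q^*y : D_hom(X)_k ⊗ D_hom(Y)_k → D_hom(X × Y)_k` is an isomorphism. Here `p` and `q` are the projection maps from
`X × Y` to `X` and `Y` respectively. *Proof.* There is a canonical decomposition `NS(X × Y) ≅ NS(X) ⊕ NS(Y) ⊕ DC(X, Y)` which is
compatible with the Künneth decomposition `H²(X × Y)(1) ≅ H²(X)(1) ⊕ H²(Y)(1) ⊕ H¹(X) ⊗ H¹(Y)(1)`. By assumption `DC(X, Y) = 0`,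
and so we obtain a diagram […] The subalgebras of `H^{2*}(X × Y)(*) = H^{2*}(X)(*) ⊗ H^{2*}(Y)(*)` generated respectively by
`D¹_hom(X × Y)_k` and `D¹_hom(X)_k ⊕ D¹_hom(Y)_k` are `D_hom(X × Y)_k` and `D_hom(X)_k ⊗ D_hom(Y)_k`, which are therefore equal.
**Corollary 4.2.** […] *Proof.* In general, `DC(X, Y) ≅ Hom(A, B)`, where `A` is the Albanese variety of `X` and `B` is the Picard
variety of `Y`. Therefore, if `A` and `B` are abelian varieties with `Hom(A, B) = 0`, then `DC(A, B) = 0` and the projection maps define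
an isomorphism `D_hom(A)_k ⊗ D_hom(B)_k → D_hom(A × B)_k`."

## Reading on the carrier, and what is PROVED

`H₁`, `H₂` `ℚ`-Hodge structures of the same weight `n` on `V`, `W` (abelian varieties: `Hᵢ = H¹(Aᵢ, ℚ)`, `H^•(A₁ × A₂) = ⋀^•(H₁ ⊕ H₂)`,
`p^* = ⋀(in₁)`, `q^* = ⋀(in₂)`, `·` = the product of the exterior algebra `⋀(V ⊕ W)`); `Dᵖ(H) = H.divisorClasses p ⊆ ⋀^{2p}` the divisor
(Lefschetz) classes, `D¹ = B¹ = Hdgₙ(⋀² H)`; the divisorial correspondences `DC(H₁, H₂) = B¹(H₁ ⊕ H₂)_{mixed}` (g26-#7/g27-#1), and the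
hypothesis "`DC = 0`" is carried as Milne's diagram `B¹(H₁ ⊕ H₂) = ⋀²in₁ B¹(H₁) ⊔ ⋀²in₂ B¹(H₂)` (equivalently `(mixed) = ⊥`, g26-#7's
`hodgeClasses_exteriorPower_prod_eq_sup_map_iff`; equivalently `Hom_HS(H₁, H₂) = 0` when `H₁` is polarized, g27-#1). Everything is read
INSIDE THE EXTERIOR ALGEBRA `⋀(V ⊕ W)` through the graded pieces `⋀^{2p}(V ⊕ W) ↪ ⋀(V ⊕ W)` (`Submodule.map … .subtype`) and the algebra
maps `J₁ = ⋀(in₁) = ExteriorAlgebra.map inl`, `J₂ = ⋀(in₂)`.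

* §1 EXTERIOR-ALGEBRA PLUMBING: a sub-module of `⋀²` commutes with every sub-module (`ExteriorLefschetz.mul_comm_of_le_exteriorPower_two`,
  from the tree's `mul_comm_of_mem_two`: even elements are central); for commuting sub-modules `X`, `Y` of an algebra,
  **`(X ⊔ Y)ᵖ = Σ_{a+b=p} Xᵃ Yᵇ`** (`ExteriorLefschetz.sup_pow_eq_sum_of_commute`; the binomial theorem in the idempotent semiring of
  sub-modules, where `C(p,a) • S = S`).
* §2 THE EASY INCLUSION (no hypothesis): **`J₁(Dᵃ(H₁)) · J₂(Dᵇ(H₂)) ⊆ D^{a+b}(H₁ ⊕ H₂)`** (`map_divisorClasses_mul_map_divisorClasses_le`: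
  pull-backs of Lefschetz classes are Lefschetz, g26-#6, and `D` is a ring) and its sum over `a + b = p`.
* §3 **MILNE'S PROPOSITION 4.1** (`map_subtype_divisorClasses_prod_eq_sum`): if `B¹(H₁ ⊕ H₂) = ⋀²in₁ B¹(H₁) ⊔ ⋀²in₂ B¹(H₂)` then for
  every `p`, **`Dᵖ(H₁ ⊕ H₂) = Σ_{a+b=p} J₁(Dᵃ(H₁)) · J₂(Dᵇ(H₂))` in `⋀(V ⊕ W)`** — verbatim Milne's proof: `D•` is the sub-algebra
  generated by `D¹` (`Dᵖ = (B¹)ᵖ`), `D¹(H₁ ⊕ H₂) = J₁ D¹(H₁) ⊕ J₂ D¹(H₂)` by hypothesis, the two summands commute (degree two), and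
  `J₁`, `J₂` are algebra maps (`Submodule.map_pow`); membership form `mem_divisorClasses_prod_iff_of_…`; the variants with the hypothesis
  as `(mixed) = ⊥` and — `H₁` POLARIZED, EVERY WEIGHT — as **`Hom_HS(H₁, H₂) = 0`** (Milne's Cor. 4.2 mechanism "`DC(A, B) ≅ Hom(A, B) = 0`",
  through g27-#1's `Polarization.hodgeClasses_two_prod_eq_sup_map_iff_subsingleton_hom_left`).

The injectivity half of "is an isomorphism" (`⊕_{a+b=p} Dᵃ ⊗ Dᵇ ↪ ⋀^{2p}(V ⊕ W)`) is Bourbaki's Künneth decomposition of `⋀(V ⊕ W)`, in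
the tree as p02's `lift_exteriorProdWedge_injective` / `iSupIndep_range_lift_exteriorProdWedge` (by name; not restated). NOT here:
Cor. 4.2's induction over `s` pairwise non-isogenous factors with multiplicities; `D_num` / `k`-coefficients other than `ℚ`.

## References

* [Milne1999LefschetzClasses] J. S. Milne, *Lefschetz classes on abelian varieties*, Duke Math. J. 96 (1999) 639–675, §4 Prop. 4.1,
  Cor. 4.2 (p. 658).
* [BourbakiAlgebre1a3] N. Bourbaki, *Algèbre*, Ch. III §7 no. 1 (graded commutativity), no. 7 Prop. 10 (`⋀(M ⊕ N) = ⋀M ⊗ ⋀N`).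
* [Lange2023AbelianVarietiesComplex] H. Lange, *Abelian Varieties over the Complex Numbers* (2023), §7.3.1 (`D•` the sub-ring generated
  by `H²_Hodge`).
-/

noncomputable section

open scoped TensorProduct
open Finset.HasAntidiagonal (antidiagonal mem_antidiagonal)

namespace Literature.AlgebraicGeometry.Motives

/-! ## §1 Exterior-algebra plumbing: commuting sub-modules and the binomial formula for `(X ⊔ Y)ᵖ` -/

namespace ExteriorLefschetz

section Binomial

variable {R : Type*} [CommSemiring R] {A : Type*} [Semiring A] [Algebra R A]

/-- In the idempotent semiring of sub-modules, `k • S = S` for `k ≠ 0` (`S + S = S ⊔ S = S`). [folklore] -/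
private theorem nsmul_submodule_eq_self {S : Submodule R A} : ∀ {k : ℕ}, k ≠ 0 → k • S = S
  | 0, h => (h rfl).elim
  | k + 1, _ => by
    rcases Nat.eq_zero_or_pos k with rfl | hk
    · rw [succ_nsmul, zero_nsmul, zero_add]
    · rw [succ_nsmul, nsmul_submodule_eq_self hk.ne', Submodule.add_eq_sup, sup_idem]

/-- **`(X ⊔ Y)ᵖ = Σ_{a+b=p} Xᵃ · Yᵇ` for commuting sub-modules `X · Y = Y · X` of an algebra** (the binomial theorem in the semiring of
sub-modules, where `⊔` is the addition and the binomial coefficients act trivially) — the mechanism of "the subalgebra generated by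
`D¹(X) ⊕ D¹(Y)` is `D(X) ⊗ D(Y)`". [cite: Milne1999LefschetzClasses, §4 Prop. 4.1 (proof, p. 658)] [cite: BourbakiAlgebre1a3, Ch. III §7 no. 7 Prop. 10] -/
theorem sup_pow_eq_sum_of_commute {X Y : Submodule R A} (h : X * Y = Y * X) (p : ℕ) :
    (X ⊔ Y) ^ p = ∑ ab ∈ antidiagonal p, X ^ ab.1 * Y ^ ab.2 := by
  have hc : Commute X Y := h
  rw [← Submodule.add_eq_sup, hc.add_pow']
  exact Finset.sum_congr rfl fun ab hab ↦
    nsmul_submodule_eq_self (Nat.choose_pos (by have := mem_antidiagonal.1 hab; omega)).ne'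

/-- A finite sum of sub-modules below `P` is below `P` (`Σ = ⨆`). [folklore] -/
private theorem sum_le_of_forall_le {ι : Type*} {s : Finset ι} {f : ι → Submodule R A} {P : Submodule R A}
    (h : ∀ i ∈ s, f i ≤ P) : ∑ i ∈ s, f i ≤ P :=
  Finset.sum_induction f (fun S ↦ S ≤ P) (fun S T hS hT ↦ by rw [Submodule.add_eq_sup]; exact sup_le hS hT)
    (by rw [Submodule.zero_eq_bot]; exact bot_le) h

/-- Membership in a finite sum of sub-modules is monotone in each summand. [folklore] -/
private theorem sum_le_sum_of_forall_le {ι : Type*} {s : Finset ι} {f g : ι → Submodule R A} (h : ∀ i ∈ s, f i ≤ g i) :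
    ∑ i ∈ s, f i ≤ ∑ i ∈ s, g i :=
  sum_le_of_forall_le fun i hi ↦ (h i hi).trans
    (Finset.single_le_sum (f := g) (fun _ _ ↦ by rw [Submodule.zero_eq_bot]; exact bot_le) hi)

end Binomial

section GradedComm

variable {K : Type*} [CommRing K] {M : Type*} [AddCommGroup M] [Module K M]

/-- **A sub-module of `⋀² M` commutes with every sub-module of `⋀ M`**: `X · T = T · X` for `X ⊆ ⋀²` (even elements of the exterior
algebra are central — the tree's `mul_comm_of_mem_two`). [cite: BourbakiAlgebre1a3, Ch. III §7 no. 1] -/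
theorem mul_comm_of_le_exteriorPower_two {X : Submodule K (ExteriorAlgebra K M)} (hX : X ≤ ⋀[K]^2 M)
    (T : Submodule K (ExteriorAlgebra K M)) : X * T = T * X :=
  le_antisymm
    (Submodule.mul_le.2 fun x hx t ht ↦ by rw [mul_comm_of_mem_two (hX hx)]; exact Submodule.mul_mem_mul ht hx)
    (Submodule.mul_le.2 fun t ht x hx ↦ by rw [← mul_comm_of_mem_two (hX hx)]; exact Submodule.mul_mem_mul hx ht)

end GradedComm

end ExteriorLefschetz

namespace HodgeStructure

universe u v

/-! ## §2 The easy inclusion `J₁(Dᵃ(H₁)) · J₂(Dᵇ(H₂)) ⊆ D^{a+b}(H₁ ⊕ H₂)` -/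

section EasyInclusion

variable {V : Type u} [AddCommGroup V] [Module ℚ V] {W : Type v} [AddCommGroup W] [Module ℚ W] {n : ℤ}
  (H₁ : HodgeStructure V n) (H₂ : HodgeStructure W n)

/-- **`p^*x · q^*y` is a divisor class of `H₁ ⊕ H₂` for divisor classes `x ∈ Dᵃ(H₁)`, `y ∈ Dᵇ(H₂)`**: in the exterior algebra,
`⋀(in₁)(Dᵃ(H₁)) · ⋀(in₂)(Dᵇ(H₂)) ⊆ D^{a+b}(H₁ ⊕ H₂)` (pull-backs of Lefschetz classes are Lefschetz — g26-#6 — and `D•` is a ring). No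
hypothesis. [cite: Milne1999LefschetzClasses, §4 Prop. 4.1 and §5 p. 662] [cite: Lange2023AbelianVarietiesComplex, §7.3.1 (chunk p0336)] -/
theorem map_divisorClasses_mul_map_divisorClasses_le (a b : ℕ) :
    ((H₁.divisorClasses a).map (⋀[ℚ]^(2 * a) V).subtype).map (ExteriorAlgebra.map (LinearMap.inl ℚ V W)).toLinearMap *
        ((H₂.divisorClasses b).map (⋀[ℚ]^(2 * b) W).subtype).map (ExteriorAlgebra.map (LinearMap.inr ℚ V W)).toLinearMap ≤
      ((H₁.prod H₂).divisorClasses (a + b)).map (⋀[ℚ]^(2 * (a + b)) (V × W)).subtype := by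
  rw [← map_subtype_map_exteriorPower_map, ← map_subtype_map_exteriorPower_map]
  refine Submodule.mul_le.2 ?_
  rintro _ ⟨x, hx, rfl⟩ _ ⟨y, hy, rfl⟩
  have hx' : x ∈ (H₁.prod H₂).divisorClasses a := (Hom.prodInl H₁ H₂).map_exteriorPower_divisorClasses_le a hx
  have hy' : y ∈ (H₁.prod H₂).divisorClasses b := (Hom.prodInr H₁ H₂).map_exteriorPower_divisorClasses_le b hy
  have hmem : (x : ExteriorAlgebra ℚ (V × W)) * (y : ExteriorAlgebra ℚ (V × W)) ∈ ⋀[ℚ]^(2 * (a + b)) (V × W) := by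
    simpa [mul_add] using SetLike.mul_mem_graded x.2 y.2
  exact ⟨⟨_, hmem⟩, mul_mem_divisorClasses (H₁.prod H₂) hx' hy' _ rfl, rfl⟩

/-- **`Σ_{a+b=p} ⋀(in₁)(Dᵃ(H₁)) · ⋀(in₂)(Dᵇ(H₂)) ⊆ Dᵖ(H₁ ⊕ H₂)`** — the image of `x ⊗ y ↦ p^*x · q^*y` always lies in the divisor classes of
the sum. [cite: Milne1999LefschetzClasses, §4 Prop. 4.1 (p. 658)] -/
theorem sum_map_divisorClasses_mul_map_divisorClasses_le (p : ℕ) :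
    ∑ ab ∈ antidiagonal p,
        ((H₁.divisorClasses ab.1).map (⋀[ℚ]^(2 * ab.1) V).subtype).map (ExteriorAlgebra.map (LinearMap.inl ℚ V W)).toLinearMap *
          ((H₂.divisorClasses ab.2).map (⋀[ℚ]^(2 * ab.2) W).subtype).map (ExteriorAlgebra.map (LinearMap.inr ℚ V W)).toLinearMap ≤
      ((H₁.prod H₂).divisorClasses p).map (⋀[ℚ]^(2 * p) (V × W)).subtype := by
  refine ExteriorLefschetz.sum_le_of_forall_le fun ab hab ↦ ?_
  obtain ⟨a, b⟩ := ab
  have h : a + b = p := mem_antidiagonal.1 hab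
  subst h
  exact map_divisorClasses_mul_map_divisorClasses_le H₁ H₂ a b

/-- **The injective half of "is an isomorphism": the products `⋀(in₁)(Dᵃ(H₁)) · ⋀(in₂)(Dᵇ(H₂))`, `a + b = p`, are INDEPENDENT
sub-modules of `⋀(V ⊕ W)`** — they sit in the distinct Künneth summands `⋀^{2a}V ⊗ ⋀^{2b}W` of `⋀^{2p}(V ⊕ W)` (Bourbaki's decomposition,
p02's `iSupIndep_range_lift_exteriorProdWedge`, each `x ⊗ y ↦ p^*x · q^*y` being injective on `⋀^{2a}V ⊗ ⋀^{2b}W`,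
`lift_exteriorProdWedge_injective`). No hypothesis. [cite: Milne1999LefschetzClasses, §4 Prop. 4.1 (p. 658)]
[cite: BourbakiAlgebre1a3, Ch. III §7 no. 7 Prop. 10 and Corollary] -/
theorem iSupIndep_map_divisorClasses_mul_map_divisorClasses (p : ℕ) :
    iSupIndep fun ab : ↥(antidiagonal p) ↦
      ((H₁.divisorClasses ab.1.1).map (⋀[ℚ]^(2 * ab.1.1) V).subtype).map (ExteriorAlgebra.map (LinearMap.inl ℚ V W)).toLinearMap *
        ((H₂.divisorClasses ab.1.2).map (⋀[ℚ]^(2 * ab.1.2) W).subtype).map (ExteriorAlgebra.map (LinearMap.inr ℚ V W)).toLinearMap := by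
  have h₁ := LinearMap.iSupIndep_map (⋀[ℚ]^(2 * p) (V × W)).subtype (⋀[ℚ]^(2 * p) (V × W)).injective_subtype
    (iSupIndep_range_lift_exteriorProdWedge (K := ℚ) (M := V) (N := W) (2 * p))
  let d : ↥(antidiagonal p) → ↥(antidiagonal (2 * p)) := fun ab ↦
    ⟨(2 * ab.1.1, 2 * ab.1.2), mem_antidiagonal.2 (by have := mem_antidiagonal.1 ab.2; omega)⟩
  have hd : Function.Injective d := by
    rintro ⟨⟨a, b⟩, hab⟩ ⟨⟨a', b'⟩, hab'⟩ h
    have h' := congrArg (fun x : ↥(antidiagonal (2 * p)) ↦ x.1) h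
    simp only [d, Prod.mk.injEq] at h'
    exact Subtype.ext (Prod.ext (by dsimp only; omega) (by dsimp only; omega))
  refine (h₁.comp hd).mono fun ab ↦ Submodule.mul_le.2 ?_
  rintro _ ⟨_, ⟨x, -, rfl⟩, rfl⟩ _ ⟨_, ⟨y, -, rfl⟩, rfl⟩
  refine ⟨exteriorProdWedge ℚ V W (mem_antidiagonal.1 (d ab).2) x y, ⟨x ⊗ₜ[ℚ] y, TensorProduct.lift.tmul x y⟩, ?_⟩
  rw [Submodule.subtype_apply, exteriorProdWedge_apply, coe_wedgeProductDeg, ExteriorLefschetz.coe_exteriorPower_map,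
    ExteriorLefschetz.coe_exteriorPower_map]
  rfl

/-! ## §3 Milne's Proposition 4.1: `DC(H₁, H₂) = 0 ⟹ D•(H₁ ⊕ H₂) = D•(H₁) ⊗ D•(H₂)` -/

/-- **MILNE 1999, PROPOSITION 4.1, ON THE ABSTRACT CARRIER.** If the divisorial correspondences vanish — Milne's diagram
`D¹(H₁ ⊕ H₂) = p^*D¹(H₁) ⊕ q^*D¹(H₂)`, i.e. `B¹(H₁ ⊕ H₂) = ⋀²in₁ B¹(H₁) ⊔ ⋀²in₂ B¹(H₂)` — then for every `p`, inside the exterior algebra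
`⋀(V ⊕ W)`: **`Dᵖ(H₁ ⊕ H₂) = Σ_{a+b=p} ⋀(in₁)(Dᵃ(H₁)) · ⋀(in₂)(Dᵇ(H₂))`** ("the map `x ⊗ y ↦ p^*x · q^*y : D(X) ⊗ D(Y) → D(X × Y)` is an
isomorphism"). Proof as printed: `D•` is the sub-algebra generated by `D¹` (`Dᵖ = (B¹)ᵖ`, `map_subtype_divisorClasses`), `D¹ = X ⊔ Y` with
`X = J₁ B¹(H₁)`, `Y = J₂ B¹(H₂)` commuting (degree two), `(X ⊔ Y)ᵖ = Σ Xᵃ Yᵇ`, and `Xᵃ = J₁((B¹)ᵃ) = J₁(Dᵃ(H₁))` (`J₁` an algebra map).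
[cite: Milne1999LefschetzClasses, §4 Prop. 4.1 (p. 658)] [cite: BourbakiAlgebre1a3, Ch. III §7 no. 1 and no. 7 Prop. 10] -/
theorem map_subtype_divisorClasses_prod_eq_sum
    (hDC : ((H₁.prod H₂).exteriorPower 2).hodgeClasses n =
      ((H₁.exteriorPower 2).hodgeClasses n).map (_root_.exteriorPower.map 2 (LinearMap.inl ℚ V W)) ⊔
        ((H₂.exteriorPower 2).hodgeClasses n).map (_root_.exteriorPower.map 2 (LinearMap.inr ℚ V W)))
    (p : ℕ) :
    ((H₁.prod H₂).divisorClasses p).map (⋀[ℚ]^(2 * p) (V × W)).subtype =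
      ∑ ab ∈ antidiagonal p,
        ((H₁.divisorClasses ab.1).map (⋀[ℚ]^(2 * ab.1) V).subtype).map (ExteriorAlgebra.map (LinearMap.inl ℚ V W)).toLinearMap *
          ((H₂.divisorClasses ab.2).map (⋀[ℚ]^(2 * ab.2) W).subtype).map (ExteriorAlgebra.map (LinearMap.inr ℚ V W)).toLinearMap := by
  have hX : (((H₁.exteriorPower 2).hodgeClasses n).map (_root_.exteriorPower.map 2 (LinearMap.inl ℚ V W))).map
      (⋀[ℚ]^2 (V × W)).subtype ≤ ⋀[ℚ]^2 (V × W) := Submodule.map_subtype_le _ _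
  have hcomm : Commute
      ((((H₁.exteriorPower 2).hodgeClasses n).map (_root_.exteriorPower.map 2 (LinearMap.inl ℚ V W))).map (⋀[ℚ]^2 (V × W)).subtype)
      ((((H₂.exteriorPower 2).hodgeClasses n).map (_root_.exteriorPower.map 2 (LinearMap.inr ℚ V W))).map (⋀[ℚ]^2 (V × W)).subtype) :=
    ExteriorLefschetz.mul_comm_of_le_exteriorPower_two hX _
  rw [map_subtype_divisorClasses, hDC, Submodule.map_sup, ExteriorLefschetz.sup_pow_eq_sum_of_commute hcomm]
  refine Finset.sum_congr rfl fun ab _ ↦ ?_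
  rw [map_subtype_map_exteriorPower_map, map_subtype_map_exteriorPower_map, ← Submodule.map_pow, ← Submodule.map_pow,
    ← map_subtype_divisorClasses, ← map_subtype_divisorClasses]

/-- Membership form of Prop. 4.1: under `DC = 0`, **a `2p`-vector of `V ⊕ W` is a divisor class of `H₁ ⊕ H₂` iff it is a sum of products
`p^*x · q^*y` of divisor classes of the factors** (`x ∈ Dᵃ(H₁)`, `y ∈ Dᵇ(H₂)`, `a + b = p`). [cite: Milne1999LefschetzClasses, §4 Prop. 4.1 (p. 658)] -/
theorem mem_divisorClasses_prod_iff_of_hodgeClasses_two_eq_sup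
    (hDC : ((H₁.prod H₂).exteriorPower 2).hodgeClasses n =
      ((H₁.exteriorPower 2).hodgeClasses n).map (_root_.exteriorPower.map 2 (LinearMap.inl ℚ V W)) ⊔
        ((H₂.exteriorPower 2).hodgeClasses n).map (_root_.exteriorPower.map 2 (LinearMap.inr ℚ V W)))
    {p : ℕ} (x : ⋀[ℚ]^(2 * p) (V × W)) :
    x ∈ (H₁.prod H₂).divisorClasses p ↔
      (x : ExteriorAlgebra ℚ (V × W)) ∈ ∑ ab ∈ antidiagonal p,
        ((H₁.divisorClasses ab.1).map (⋀[ℚ]^(2 * ab.1) V).subtype).map (ExteriorAlgebra.map (LinearMap.inl ℚ V W)).toLinearMap *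
          ((H₂.divisorClasses ab.2).map (⋀[ℚ]^(2 * ab.2) W).subtype).map (ExteriorAlgebra.map (LinearMap.inr ℚ V W)).toLinearMap := by
  rw [← map_subtype_divisorClasses_prod_eq_sum H₁ H₂ hDC p]
  exact ⟨fun h ↦ ⟨x, h, rfl⟩, fun ⟨y, hy, hxy⟩ ↦ by rwa [← Subtype.coe_injective hxy]⟩

/-- Prop. 4.1 with the hypothesis in the form **"the mixed part of `B¹(H₁ ⊕ H₂)` vanishes"** (`B¹ ⊓ ker ⋀²pr₁ ⊓ ker ⋀²pr₂ = 0`, g26-#7's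
equivalent reading of `DC(X, Y) = 0`). [cite: Milne1999LefschetzClasses, §4 Prop. 4.1 (p. 658)] -/
theorem map_subtype_divisorClasses_prod_eq_sum_of_mixed_eq_bot
    (hDC : ((H₁.prod H₂).exteriorPower 2).hodgeClasses n ⊓ LinearMap.ker (_root_.exteriorPower.map 2 (LinearMap.fst ℚ V W)) ⊓
      LinearMap.ker (_root_.exteriorPower.map 2 (LinearMap.snd ℚ V W)) = ⊥)
    (p : ℕ) :
    ((H₁.prod H₂).divisorClasses p).map (⋀[ℚ]^(2 * p) (V × W)).subtype =
      ∑ ab ∈ antidiagonal p,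
        ((H₁.divisorClasses ab.1).map (⋀[ℚ]^(2 * ab.1) V).subtype).map (ExteriorAlgebra.map (LinearMap.inl ℚ V W)).toLinearMap *
          ((H₂.divisorClasses ab.2).map (⋀[ℚ]^(2 * ab.2) W).subtype).map (ExteriorAlgebra.map (LinearMap.inr ℚ V W)).toLinearMap :=
  map_subtype_divisorClasses_prod_eq_sum H₁ H₂ ((hodgeClasses_exteriorPower_prod_eq_sup_map_iff H₁ H₂ two_ne_zero n).2 hDC) p

end EasyInclusion

/-! ### Corollary 4.2's mechanism: `DC(H₁, H₂) ≅ Hom_HS(H₁, H₂) = 0` (one polarization, every weight — g27-#1) -/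

section Hom

variable {V : Type u} [AddCommGroup V] [Module ℚ V] [Module.Finite ℚ V] {W : Type u} [AddCommGroup W] [Module ℚ W] {n : ℤ}
  [HodgeTensorFacts.{u, u}] {H₁ : HodgeStructure V n} (Q₁ : Polarization H₁) (H₂ : HodgeStructure W n)

include Q₁ in
/-- **`Hom_HS(H₁, H₂) = 0 ⟹ D•(H₁ ⊕ H₂) = D•(H₁) ⊗ D•(H₂)`** (`H₁` polarized, every weight): "`DC(A, B) ≅ Hom(A, B)` […] if
`Hom(A, B) = 0`, then `DC(A, B) = 0` and the projection maps define an isomorphism `D(A) ⊗ D(B) → D(A × B)`" — `DC = B¹_{mixed} ≃ Hom_HS`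
is g27-#1's `Polarization.homEquivMixedDivisorClasses`. [cite: Milne1999LefschetzClasses, §4 Prop. 4.1 and Cor. 4.2 (proof) (p. 658)] -/
theorem Polarization.map_subtype_divisorClasses_prod_eq_sum_of_subsingleton_hom [Subsingleton (Hom H₁ H₂)] (p : ℕ) :
    ((H₁.prod H₂).divisorClasses p).map (⋀[ℚ]^(2 * p) (V × W)).subtype =
      ∑ ab ∈ antidiagonal p,
        ((H₁.divisorClasses ab.1).map (⋀[ℚ]^(2 * ab.1) V).subtype).map (ExteriorAlgebra.map (LinearMap.inl ℚ V W)).toLinearMap *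
          ((H₂.divisorClasses ab.2).map (⋀[ℚ]^(2 * ab.2) W).subtype).map (ExteriorAlgebra.map (LinearMap.inr ℚ V W)).toLinearMap :=
  map_subtype_divisorClasses_prod_eq_sum H₁ H₂ ((Q₁.hodgeClasses_two_prod_eq_sup_map_iff_subsingleton_hom_left H₂).2 ‹_›) p

include Q₁ in
/-- Membership form: for `Hom_HS(H₁, H₂) = 0` (`H₁` polarized), **the divisor classes of `H₁ ⊕ H₂` are exactly the sums of products
`p^*x · q^*y` of divisor classes of the factors**. [cite: Milne1999LefschetzClasses, §4 Prop. 4.1 and Cor. 4.2 (proof) (p. 658)] -/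
theorem Polarization.mem_divisorClasses_prod_iff_of_subsingleton_hom [Subsingleton (Hom H₁ H₂)] {p : ℕ} (x : ⋀[ℚ]^(2 * p) (V × W)) :
    x ∈ (H₁.prod H₂).divisorClasses p ↔
      (x : ExteriorAlgebra ℚ (V × W)) ∈ ∑ ab ∈ antidiagonal p,
        ((H₁.divisorClasses ab.1).map (⋀[ℚ]^(2 * ab.1) V).subtype).map (ExteriorAlgebra.map (LinearMap.inl ℚ V W)).toLinearMap *
          ((H₂.divisorClasses ab.2).map (⋀[ℚ]^(2 * ab.2) W).subtype).map (ExteriorAlgebra.map (LinearMap.inr ℚ V W)).toLinearMap :=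
  mem_divisorClasses_prod_iff_of_hodgeClasses_two_eq_sup H₁ H₂
    ((Q₁.hodgeClasses_two_prod_eq_sup_map_iff_subsingleton_hom_left H₂).2 ‹_›) x

end Hom

end HodgeStructure

end Literature.AlgebraicGeometry.Motives

end
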